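import Literature.NumberTheory.Transcendental.RoySmallValueEstimatesZeroCycleProofs
import Literature.NumberTheory.Transcendental.RoySmallValueEstimatesTauFixedPointsProofs
import Literature.NumberTheory.Transcendental.RoySmallValueEstimatesOrbitBridgeProofs
import Literature.NumberTheory.Transcendental.RoySmallValueEstimatesConjClassProofs
import HarnessLib

/-!
# Small value estimates at rational translates (Nguyen–Roy 2016) — proofs: Proposition 14 for conjugate sets

Proofs file towards `Literature.NumberTheory.Transcendental.nguyenRoy2016_thm_1` (Nguyen–Roy, IJNT 12
(2016) = arXiv:1412.5163): **§5, Proposition 14** for the conjugate set of an algebraic point (the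
`pts` of `NguyenRoy.EndgameData`) — the packing of the translates `τⁱ(Z)`, `0 ≤ i < T`, into
`W = 𝒵(P̃_D, Q)` (pair package `NguyenRoy.PairPkg` of `RoySmallValueEstimatesZeroCycleProofs`), the
fixed-point dichotomy (`RoySmallValueEstimatesTauFixedPointsProofs`), and the degree / height bounds
with symbolic constants in the Weil-height currency `ht = deg · h_abs` (Lemma 11 of
`RoySmallValueEstimatesAlgPointLiouvilleProofs`). Everything here is PROVED; no named facts. Two parts:

### Part 1: packing the translates `τⁱ(Z)`, `0 ≤ i < T`, into `W` (the counting step of Proposition 14)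

With `W = 𝒵(P̃, Q̃)` packaged as `L : NguyenRoy.PairPkg D P̃ Q̃` (`RoySmallValueEstimatesZeroCycleProofs`: its points `L.pt i`,
`i < L.m ≤ D²`, `card_le`, `mul_sum_habs_le`) and `Z` an arbitrary finite set `S ⊆ ℙ²(ℂ)` (the
consumer takes `S = ` the conjugates of an algebraic point), Part 1 proves the counting step in
the Weil-height currency of the endgame (`habs`):

* `tauMatPow_mulVec_ne_zero`, `tauP_eq_mk`, `eval_rep_tauP_eq_zero_iff` — `τⁱ[v] = [τ̲ⁱv]`, and a
  form vanishes at (the representative of) `τⁱp` iff it vanishes at `τ̲ⁱ p.rep`;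
* **`le_of_disjoint_translates`** — if the translates `τⁱ(S)`, `0 ≤ i < T`, are pairwise disjoint
  and consist of common zeros of `P̃, Q̃`, then `T · #S ≤ m ≤ D²` and
  `D · ∑_{i<T} ∑_{p∈S} h_abs(τⁱp) ≤ log 𝓛(Φ(P̃, Q̃, ·))` (the two displayed sums against `deg W`,
  `h(W)`);
* **`translates_dichotomy`** — if the translates `τⁱ(S)`, `0 ≤ i < T`, are pairwise EQUAL OR
  DISJOINT (as Galois orbits are), then either every point of `S` is one of the two fixed points
  `(0:1:0), (0:0:1)` of the powers of `τ` (`RoySmallValueEstimatesTauFixedPointsProofs`, `image_tauP_injective`), or they are pairwise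
  disjoint; `habs_mk_e010`, `habs_mk_e001` — the fixed points have absolute height `0` ("`h(Z) = 0`");
* **`prop14_counting`** — the two combined, with the membership `Z ⊆ W_D` in the pointwise form
  `P̃(τ̲ʲ q̲) = 0` (`q ∈ S`, `0 ≤ j < 2T`) and `D ≤ T` (`RoySmallValueEstimatesZeroCycleProofs`, `common_zero_of_translates`, for the
  Nguyen–Roy companion `Q = compQ D Qᵢ t`).

### Part 2: Proposition 14 for the conjugate set of an algebraic point

With `Z` the conjugate set `conj P` of an algebraic point `P` (`RoySmallValueEstimatesAlgPointProofs`,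
the `V`/`pts` of `NguyenRoy.EndgameData`), `W = 𝒵(P̃, Q)` a pair package `L` (`RoySmallValueEstimatesZeroCycleProofs`) and the
counting step of Part 1 (`prop14_counting`), Part 2 proves Proposition 14 with symbolic
constants, in the Weil-height currency `ht = deg · h_abs`:

* `image_conj_tauP_eq_or_disjoint` (from `AlgPt.conj_eq_or_disjoint` of
  `RoySmallValueEstimatesConjClassProofs`): the translates
  `τⁱ(conj P) = conj(τⁱP)` are pairwise equal or disjoint;
* `sum_conj_habs_tauP` — `∑_{q ∈ conj P} h_abs(τᵏq) = ht(τᵏP)`;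
* **`prop14_deg_le`**, **`prop14_ht_le`** — if `conj P ⊆ W_D` pointwise (`P̃(τ̲ʲq̲) = 0`, `j < 2T`),
  `D ≤ T`, `1 ≤ T`: `deg(τⁱP) = deg P ≤ 2 + m/T ≤ 2 + D²/T` for all `i`, and
  `ht(τⁱP) ≤ log 𝓛(Φ(P̃, Q, ·))/(D T) + 4 c₄ T · (2 + D²/T)`-type bound for `|i| < 3T`
  (precisely: `ht(τⁱP) ≤ H/(DT) + c₄ · 4T · deg P` with `T deg P ≤ D²` or `deg P ≤ 2`), from the
  dichotomy of Part 1 (fixed points: `deg ≤ 2`, `ht = 0`; otherwise the packing bounds) and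
  Lemma 11 (`AlgPt.ht_tauA_le`).

## References

* [NguyenRoy2016] N. A. V. Nguyen, D. Roy, *A small value estimate in dimension two involving
  translations by rational points*, IJNT 12 (2016) 1273–1293 = arXiv:1412.5163, §§4–5
  (Lemma 11, Propositions 14, 15, Corollary 16, Proposition 10).
* [Roy2013] D. Roy, *A small value estimate for 𝔾ₐ × 𝔾ₘ*, Mathematika 59 (2013), 333–363
  (arXiv:1301.0663), Propositions 2.3, 2.4, 6.1, 6.2, 6.4 (the arguments being transposed).
-/

noncomputable section

open MvPolynomial Finset Module Height NumberField
open scoped Matrix Classical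

namespace Literature.NumberTheory.Transcendental

namespace NguyenRoy

open Roy2013
open Nesterenko hiding tau

section translates

variable {r s : ℂ}

/-- `τ̲ⁱ v ≠ 0` for `v ≠ 0`. [folklore] -/
theorem tauMatPow_mulVec_ne_zero (r : ℂ) (hs : s ≠ 0) (i : ℤ) {v : V3} (hv : v ≠ 0) :
    tauMatPow r s i *ᵥ v ≠ 0 := by
  intro h
  apply hv
  have h2 := congrArg (fun w => tauMatPow r s (-i) *ᵥ w) h
  simp only [tauMatPow_mulVec_tauMatPow r hs, neg_add_cancel, tauMatPow_zero, Matrix.one_mulVec,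
    Matrix.mulVec_zero] at h2
  exact h2

/-- `τⁱ[v] = [τ̲ⁱ v]` on the chosen representative. [cite: NguyenRoy2016, §2] -/
theorem tauP_eq_mk (r : ℂ) (hs : s ≠ 0) (i : ℤ) (p : PPt) :
    tauP r hs i p = Projectivization.mk ℂ (tauMatPow r s i *ᵥ p.rep)
      (tauMatPow_mulVec_ne_zero r hs i p.rep_nonzero) := by
  conv_lhs => rw [← Projectivization.mk_rep p]
  rw [tauP_mk]
  simp only [tauMat_zpow r hs]

/-- A form vanishes at (the representative of) `τⁱp` iff it vanishes at `τ̲ⁱ p.rep`. [folklore] -/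
theorem eval_rep_tauP_eq_zero_iff (r : ℂ) (hs : s ≠ 0) {P : CX} {n : ℕ} (hP : P.IsHomogeneous n)
    (i : ℤ) (p : PPt) :
    eval (tauP r hs i p).rep P = 0 ↔ eval (tauMatPow r s i *ᵥ p.rep) P = 0 := by
  rw [tauP_eq_mk r hs]
  exact eval_rep_mk_eq_zero_iff hP _

variable {D : ℕ} {Pt Qt : MvPolynomial (Fin 3) ℤ}

/-- **Distinct translates inside `W`**: if the translates `τⁱ(S)`, `0 ≤ i < T`, of a finite set
`S ⊆ ℙ²(ℂ)` are pairwise disjoint and consist of common zeros of `P̃, Q̃`, then `T · #S ≤ m (≤ D²)`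
and `D · ∑_{i<T} ∑_{p∈S} h_abs(τⁱ p) ≤ log 𝓛(Φ(P̃, Q̃, ·))`.
[cite: NguyenRoy2016, proof of Proposition 14 (`∑ deg(τⁱZ) ≤ deg W`, `∑ h(τⁱZ) ≤ h(W)`)] -/
theorem le_of_disjoint_translates [DecidableEq PPt] (r : ℂ) (hs : s ≠ 0) (L : PairPkg D Pt Qt)
    {S : Finset PPt} {T : ℕ}
    (hdisj : ∀ i < T, ∀ j < T, i ≠ j →
      Disjoint (S.image (tauP r hs i)) (S.image (tauP r hs j)))
    (hzero : ∀ i < T, ∀ p ∈ S, eval (tauP r hs i p).rep (map (Int.castRingHom ℂ) Pt) = 0 ∧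
      eval (tauP r hs i p).rep (map (Int.castRingHom ℂ) Qt) = 0) :
    T * S.card ≤ L.m ∧
      (D : ℝ) * ∑ i ∈ range T, ∑ p ∈ S, habs (tauP r hs i p) ≤
        Real.log (∑ n ∈ L.intF.support, |((coeff n L.intF : ℤ) : ℝ)|) := by
  set U : Finset PPt := (range T).biUnion fun i : ℕ => S.image (tauP r hs i) with hUdef
  have hU : ∀ q ∈ U, eval q.rep (map (Int.castRingHom ℂ) Pt) = 0 ∧
      eval q.rep (map (Int.castRingHom ℂ) Qt) = 0 := by
    intro q hq
    obtain ⟨i, hi, hq'⟩ := mem_biUnion.mp hq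
    obtain ⟨p, hp, rfl⟩ := mem_image.mp hq'
    exact hzero i (mem_range.mp hi) p hp
  have hdisj' : ∀ i ∈ range T, ∀ j ∈ range T, i ≠ j →
      Disjoint (S.image (tauP r hs i)) (S.image (tauP r hs j)) := fun i hi j hj hij =>
    hdisj i (mem_range.mp hi) j (mem_range.mp hj) hij
  have hcardU : U.card = T * S.card := by
    rw [hUdef, card_biUnion hdisj']
    simp_rw [card_image_of_injective _ (tauP_injective r hs _)]
    rw [sum_const, card_range, smul_eq_mul]
  have hsumU : ∑ q ∈ U, habs q = ∑ i ∈ range T, ∑ p ∈ S, habs (tauP r hs i p) := by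
    rw [hUdef, sum_biUnion hdisj']
    refine sum_congr rfl fun i _ => ?_
    rw [sum_image fun p _ q _ h => tauP_injective r hs _ h]
  refine ⟨?_, ?_⟩
  · rw [← hcardU]
    exact L.card_le U hU
  · rw [← hsumU]
    exact L.mul_sum_habs_le U hU

/-- **The dichotomy**: if the translates `τⁱ(S)`, `0 ≤ i < T`, are pairwise equal or disjoint
(e.g. Galois orbits of algebraic points), then either every point of `S` is one of the two fixed
points `(0:1:0)`, `(0:0:1)` of the non-trivial powers of `τ`, or the translates are pairwise
disjoint. [cite: NguyenRoy2016, proof of Proposition 14 ("If the sets `τⁱ(Z)` are not all distinct …")] -/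
theorem translates_dichotomy [DecidableEq PPt] (hr : r ≠ 0) (hs : s ≠ 0)
    (hs1 : ∀ k : ℤ, k ≠ 0 → s ^ k ≠ 1)
    (S : Finset PPt) (T : ℕ)
    (horb : ∀ i < T, ∀ j < T, S.image (tauP r hs i) = S.image (tauP r hs j) ∨
      Disjoint (S.image (tauP r hs i)) (S.image (tauP r hs j))) :
    (∀ a ∈ S, a = Projectivization.mk ℂ ![0, 1, 0] e010_ne_zero ∨
        a = Projectivization.mk ℂ ![0, 0, 1] e001_ne_zero) ∨
      ∀ i < T, ∀ j < T, i ≠ j → Disjoint (S.image (tauP r hs i)) (S.image (tauP r hs j)) := by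
  by_cases h : ∃ a ∈ S, a ≠ Projectivization.mk ℂ ![0, 1, 0] e010_ne_zero ∧
      a ≠ Projectivization.mk ℂ ![0, 0, 1] e001_ne_zero
  · right
    obtain ⟨a, ha, ha1, ha2⟩ := h
    intro i hi j hj hij
    rcases horb i hi j hj with heq | hd
    · exfalso
      have hinj := image_tauP_injective hr hs hs1 ha ha1 ha2 heq
      exact hij (by exact_mod_cast hinj)
    · exact hd
  · left
    push Not at h
    intro a ha
    by_cases h1 : a = Projectivization.mk ℂ ![0, 1, 0] e010_ne_zero
    · exact Or.inl h1
    · exact Or.inr (h a ha h1)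

/-! ### The fixed points have height `0` -/

/-- `habs` on a representative given by an embedded tuple. [folklore] -/
theorem habs_mk_of_eq {K : Type} [Field K] [NumberField K] (ι : K →+* ℂ) (a : Fin 3 → K)
    {v : V3} (hv : v ≠ 0) (h : (fun j => ι (a j)) = v) :
    habs (Projectivization.mk ℂ v hv) = logHeight a / finrank ℚ K := by
  subst h
  exact habs_mk ι a hv

/-- `h_abs((0:1:0)) = 0`. [cite: NguyenRoy2016, proof of Proposition 14 ("`deg(Z) = 1` and `h(Z) = 0`")] -/
theorem habs_mk_e010 : habs (Projectivization.mk ℂ ![0, 1, 0] e010_ne_zero) = 0 := by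
  rw [habs_mk_of_eq (algebraMap ℚ ℂ) (![0, 1, 0] : Fin 3 → ℚ) e010_ne_zero
    (by funext j; fin_cases j <;> simp)]
  simp [logHeight_eq_zero_of_subsingleton]

/-- `h_abs((0:0:1)) = 0`. [cite: NguyenRoy2016, proof of Proposition 14 ("`deg(Z) = 1` and `h(Z) = 0`")] -/
theorem habs_mk_e001 : habs (Projectivization.mk ℂ ![0, 0, 1] e001_ne_zero) = 0 := by
  rw [habs_mk_of_eq (algebraMap ℚ ℂ) (![0, 0, 1] : Fin 3 → ℚ) e001_ne_zero
    (by funext j; fin_cases j <;> simp)]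
  simp [logHeight_eq_zero_of_subsingleton]

/-- The fixed points are fixed by every `τⁱ` (so a set of fixed points equals all its translates).
[cite: NguyenRoy2016, proof of Proposition 14] -/
theorem tauP_eq_self_of_fixed (r : ℂ) (hs : s ≠ 0) (i : ℤ) {a : PPt}
    (ha : a = Projectivization.mk ℂ ![0, 1, 0] e010_ne_zero ∨
      a = Projectivization.mk ℂ ![0, 0, 1] e001_ne_zero) :
    tauP r hs i a = a := by
  rcases ha with rfl | rfl
  · exact tauP_e010 r hs i
  · exact tauP_e001 r hs i

/-! ### Proposition 14, counting step, for the Nguyen–Roy companion -/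

/-- **Proposition 14, counting step.** Let `W = 𝒵(P̃, Q)` with `Q = ∑ tʲ Qⱼ` the Nguyen–Roy
companion (`Qⱼ` integral models of `ΦʲP̃`, `1 ≤ j ≤ D`), packaged as `L`, and let `S ⊆ ℙ²(ℂ)` be a
finite set contained in `W_D` in the pointwise sense `P̃(τ̲ʲq̲) = 0` for `q ∈ S`, `0 ≤ j < 2T`, with
`D ≤ T`, whose translates `τⁱ(S)`, `0 ≤ i < T`, are pairwise equal or disjoint. Then either `S`
consists of fixed points `(0:1:0), (0:0:1)` (absolute height `0`), or `T · #S ≤ m ≤ D²` and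
`D ∑_{i<T} ∑_{q∈S} h_abs(τⁱq) ≤ log 𝓛(Φ(P̃, Q, ·))`.
[cite: NguyenRoy2016, Proposition 14 and its proof] -/
theorem prop14_counting [DecidableEq PPt] (hr : r ≠ 0) (hs : s ≠ 0)
    (hs1 : ∀ k : ℤ, k ≠ 0 → s ^ k ≠ 1)
    {Qi : ℕ → MvPolynomial (Fin 3) ℤ} {t : ℕ} (L : PairPkg D Pt (compQ D Qi t))
    (hQi : ∀ j ∈ Icc 1 D, map (Int.castRingHom ℂ) (Qi j) =
      tau (j * r) (s ^ j) (map (Int.castRingHom ℂ) Pt))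
    {S : Finset PPt} {T : ℕ} (hDT : D ≤ T)
    (hW : ∀ q ∈ S, ∀ j : ℕ, j < 2 * T →
      eval (tauMatPow r s j *ᵥ q.rep) (map (Int.castRingHom ℂ) Pt) = 0)
    (horb : ∀ i < T, ∀ j < T, S.image (tauP r hs i) = S.image (tauP r hs j) ∨
      Disjoint (S.image (tauP r hs i)) (S.image (tauP r hs j))) :
    (∀ a ∈ S, a = Projectivization.mk ℂ ![0, 1, 0] e010_ne_zero ∨
        a = Projectivization.mk ℂ ![0, 0, 1] e001_ne_zero) ∨
      (T * S.card ≤ L.m ∧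
        (D : ℝ) * ∑ i ∈ range T, ∑ p ∈ S, habs (tauP r hs i p) ≤
          Real.log (∑ n ∈ L.intF.support, |((coeff n L.intF : ℤ) : ℝ)|)) := by
  rcases translates_dichotomy hr hs hs1 S T horb with hfix | hdisj
  · exact Or.inl hfix
  · refine Or.inr (le_of_disjoint_translates r hs L hdisj fun i hi p hp => ?_)
    have hc := common_zero_of_translates hs hQi t hDT (hW p hp) hi
    rw [eval_rep_tauP_eq_zero_iff r hs L.hP, eval_rep_tauP_eq_zero_iff r hs L.hQ]
    exact_mod_cast hc

end translates

/-! ### Conjugate sets are equivalence classes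

`AlgPt.conj_eq_or_disjoint` (conjugate sets sharing a point coincide) is the instantiation's
(`RoySmallValueEstimatesConjClassProofs`). -/

/-! ### Translates of a conjugate set -/

section translates

variable (r : ℚ) {s : ℚ} (hs : s ≠ 0)

/-- `conj(τᵏP) = τᵏ(conj P)` with `τ = tauP` and `k ∈ ℕ`. [cite: NguyenRoy2016, §4 (τZ)] -/
theorem conj_tauA_natCast (P : AlgPt) (k : ℕ) :
    (P.tauA r hs k).conj = P.conj.image (tauP (r : ℂ) (cast_ne_zero' hs) k) :=
  P.conj_tauA r hs k

/-- **The translates `τⁱ(conj P)`, `τʲ(conj P)` are equal or disjoint.**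
[cite: NguyenRoy2016, proof of Proposition 14 ("If the sets `τⁱ(Z)` (`i ∈ ℤ`) are not all distinct …")] -/
theorem image_conj_tauP_eq_or_disjoint (P : AlgPt) (i j : ℕ) :
    P.conj.image (tauP (r : ℂ) (cast_ne_zero' hs) i) = P.conj.image (tauP (r : ℂ) (cast_ne_zero' hs) j) ∨
      Disjoint (P.conj.image (tauP (r : ℂ) (cast_ne_zero' hs) i))
        (P.conj.image (tauP (r : ℂ) (cast_ne_zero' hs) j)) := by
  rw [← conj_tauA_natCast r hs P i, ← conj_tauA_natCast r hs P j]
  exact AlgPt.conj_eq_or_disjoint _ _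

/-- **`∑_{q ∈ conj P} h_abs(τᵏ q) = ht(τᵏP)`.** [cite: NguyenRoy2016, §4, Lemma 11] -/
theorem sum_conj_habs_tauP (P : AlgPt) (k : ℕ) :
    ∑ q ∈ P.conj, habs (tauP (r : ℂ) (cast_ne_zero' hs) k q) = (P.tauA r hs k).ht := by
  rw [← sum_image fun a _ b _ h => tauP_injective (r : ℂ) (cast_ne_zero' hs) k h,
    ← conj_tauA_natCast r hs P k, AlgPt.ht,
    sum_congr rfl fun q hq => (P.tauA r hs k).habs_of_mem_conj hq, sum_const, AlgPt.card_conj,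
    nsmul_eq_mul]

/-! ### Proposition 14 -/

variable {D : ℕ} {Pt : MvPolynomial (Fin 3) ℤ} {Qi : ℕ → MvPolynomial (Fin 3) ℤ} {t : ℕ}

/-- **Proposition 14, dichotomy for a conjugate set in `W_D`.** For `P` algebraic with
`conj P ⊆ W_D` pointwise (`P̃(τ̲ʲq̲) = 0` for `q ∈ conj P`, `j < 2T`), `D ≤ T`, `r ≠ 0`, `s ≠ 0, ±1`:
either every conjugate of `P` is a fixed point `(0:1:0)`, `(0:0:1)`, or
`T · deg P ≤ m (≤ D²)` and `D ∑_{k<T} ht(τᵏP) ≤ log 𝓛(Φ(P̃, Q, ·))`.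
[cite: NguyenRoy2016, Proposition 14 and its proof] -/
theorem prop14_dichotomy (hr : r ≠ 0) (hs1 : s ≠ 1) (hs2 : s ≠ -1)
    (L : PairPkg D Pt (compQ D Qi t))
    (hQi : ∀ j ∈ Icc 1 D, map (Int.castRingHom ℂ) (Qi j) =
      tau (j * (r : ℂ)) ((s : ℂ) ^ j) (map (Int.castRingHom ℂ) Pt))
    (P : AlgPt) {T : ℕ} (hDT : D ≤ T)
    (hW : ∀ q ∈ P.conj, ∀ j : ℕ, j < 2 * T →
      eval (tauMatPow (r : ℂ) (s : ℂ) j *ᵥ q.rep) (map (Int.castRingHom ℂ) Pt) = 0) :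
    (∀ a ∈ P.conj, a = Projectivization.mk ℂ ![0, 1, 0] e010_ne_zero ∨
        a = Projectivization.mk ℂ ![0, 0, 1] e001_ne_zero) ∨
      (T * P.deg ≤ L.m ∧
        (D : ℝ) * ∑ k ∈ range T, (P.tauA r hs k).ht ≤
          Real.log (∑ n ∈ L.intF.support, |((coeff n L.intF : ℤ) : ℝ)|)) := by
  have hrC : (r : ℂ) ≠ 0 := by exact_mod_cast hr
  have hs1' : ∀ k : ℤ, k ≠ 0 → (s : ℂ) ^ k ≠ 1 := fun k hk => rat_cast_zpow_ne_one hs1 hs2 hk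
  rcases prop14_counting hrC (cast_ne_zero' hs) hs1' L hQi hDT hW
    (fun i _ j _ => image_conj_tauP_eq_or_disjoint r hs P i j) with hfix | ⟨hcard, hsum⟩
  · exact Or.inl hfix
  · refine Or.inr ⟨by rw [← P.card_conj]; exact hcard, ?_⟩
    rw [sum_congr rfl fun k _ => (sum_conj_habs_tauP r hs P k)] at hsum
    exact hsum

/-- In the fixed-point case the conjugate set has at most two points. [cite: NguyenRoy2016, proof of Proposition 14 ("`deg(Z) = 1`")] -/
theorem deg_le_two_of_fixed (P : AlgPt)
    (hfix : ∀ a ∈ P.conj, a = Projectivization.mk ℂ ![0, 1, 0] e010_ne_zero ∨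
      a = Projectivization.mk ℂ ![0, 0, 1] e001_ne_zero) : P.deg ≤ 2 := by
  rw [← P.card_conj]
  have hsub : P.conj ⊆ {Projectivization.mk ℂ ![0, 1, 0] e010_ne_zero,
      Projectivization.mk ℂ ![0, 0, 1] e001_ne_zero} := by
    intro a ha
    rcases hfix a ha with h | h <;> simp [h]
  exact (card_le_card hsub).trans (card_le_two)

/-- In the fixed-point case every translate has height `0`. [cite: NguyenRoy2016, proof of Proposition 14 ("`h(Z) = 0`")] -/
theorem ht_tauA_eq_zero_of_fixed (P : AlgPt)
    (hfix : ∀ a ∈ P.conj, a = Projectivization.mk ℂ ![0, 1, 0] e010_ne_zero ∨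
      a = Projectivization.mk ℂ ![0, 0, 1] e001_ne_zero) (i : ℤ) : (P.tauA r hs i).ht = 0 := by
  have h1 : (P.tauA r hs i).1 = P.1 := by
    rw [AlgPt.tauA_val]
    exact tauP_eq_self_of_fixed (r : ℂ) (cast_ne_zero' hs) i (hfix P.1 P.self_mem_conj)
  have h2 : habs (P.tauA r hs i).1 = 0 := by
    rw [h1]
    rcases hfix P.1 P.self_mem_conj with h | h
    · rw [h]; exact habs_mk_e010
    · rw [h]; exact habs_mk_e001
  rw [AlgPt.ht, h2, mul_zero]

/-- **Proposition 14, degree bound**: `deg(τⁱP) = deg P ≤ max(2, m/T) ≤ 2 + m/T` (`m ≤ D²`).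
[cite: NguyenRoy2016, Proposition 14 (`deg(τⁱ(Z)) ≤ 2D^{2−σ}`: here `deg ≤ 2 + D²/T`)] -/
theorem prop14_deg_le (hr : r ≠ 0) (hs1 : s ≠ 1) (hs2 : s ≠ -1)
    (L : PairPkg D Pt (compQ D Qi t))
    (hQi : ∀ j ∈ Icc 1 D, map (Int.castRingHom ℂ) (Qi j) =
      tau (j * (r : ℂ)) ((s : ℂ) ^ j) (map (Int.castRingHom ℂ) Pt))
    (P : AlgPt) {T : ℕ} (hT1 : 1 ≤ T) (hDT : D ≤ T)
    (hW : ∀ q ∈ P.conj, ∀ j : ℕ, j < 2 * T →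
      eval (tauMatPow (r : ℂ) (s : ℂ) j *ᵥ q.rep) (map (Int.castRingHom ℂ) Pt) = 0) (i : ℤ) :
    ((P.tauA r hs i).deg : ℝ) ≤ 2 + (L.m : ℝ) / T := by
  rw [P.deg_tauA r hs i]
  have hT : (0 : ℝ) < T := by exact_mod_cast hT1
  have hm0 : (0 : ℝ) ≤ (L.m : ℝ) / T := by positivity
  rcases prop14_dichotomy r hs hr hs1 hs2 L hQi P hDT hW with hfix | ⟨hcard, -⟩
  · have := deg_le_two_of_fixed P hfix
    have h2 : (P.deg : ℝ) ≤ 2 := by exact_mod_cast this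
    linarith
  · have h1 : (T : ℝ) * P.deg ≤ L.m := by exact_mod_cast hcard
    have h2 : (P.deg : ℝ) ≤ (L.m : ℝ) / T := by
      rw [le_div_iff₀ hT]; linarith
    linarith

/-- **Proposition 14, height bound**: for `|i| < 3T`,
`ht(τⁱP) ≤ H/(DT) + 4 c₄ T deg P` with `H = log 𝓛(Φ(P̃, Q, ·))` — and in the second case
`T deg P ≤ m ≤ D²`, so that this is `≤ H/(DT) + 4c₄D²`; in the fixed-point case `ht(τⁱP) = 0`.
Stated as `ht(τⁱP) ≤ H/(DT) + 4 c₄ D²` using `T · deg P ≤ D²` or `ht = 0`.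
[cite: NguyenRoy2016, Proposition 14 (`h(τⁱ(Z)) ≤ h(W)/T + O(T deg Z)`) and Lemma 11] -/
theorem prop14_ht_le (hr : r ≠ 0) (hs1 : s ≠ 1) (hs2 : s ≠ -1) (hD : 1 ≤ D)
    (L : PairPkg D Pt (compQ D Qi t))
    (hQi : ∀ j ∈ Icc 1 D, map (Int.castRingHom ℂ) (Qi j) =
      tau (j * (r : ℂ)) ((s : ℂ) ^ j) (map (Int.castRingHom ℂ) Pt))
    (P : AlgPt) {T : ℕ} (hT1 : 1 ≤ T) (hDT : D ≤ T)
    (hW : ∀ q ∈ P.conj, ∀ j : ℕ, j < 2 * T →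
      eval (tauMatPow (r : ℂ) (s : ℂ) j *ᵥ q.rep) (map (Int.castRingHom ℂ) Pt) = 0)
    {i : ℤ} (hi : |i| < 3 * T) :
    (P.tauA r hs i).ht ≤
      Real.log (∑ n ∈ L.intF.support, |((coeff n L.intF : ℤ) : ℝ)|) / (D * T) +
        4 * AlgPt.c4 r s * (D : ℝ) ^ 2 := by
  set H : ℝ := Real.log (∑ n ∈ L.intF.support, |((coeff n L.intF : ℤ) : ℝ)|) with hH
  have hH0 : 0 ≤ H := Real.log_nonneg L.one_le_length_intF
  have hc4 : 0 ≤ AlgPt.c4 r s := AlgPt.c4_nonneg r hs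
  have hT : (0 : ℝ) < T := by exact_mod_cast hT1
  have hDr : (0 : ℝ) < D := by exact_mod_cast hD
  rcases prop14_dichotomy r hs hr hs1 hs2 L hQi P hDT hW with hfix | ⟨hcard, hsum⟩
  · rw [ht_tauA_eq_zero_of_fixed r hs P hfix i]
    positivity
  · -- a translate `τ^{k₀} P`, `k₀ < T`, of height `≤ H/(DT)`
    have hne : (range T).Nonempty := ⟨0, mem_range.mpr hT1⟩
    obtain ⟨k₀, hk₀, hmin⟩ := exists_min_image (range T) (fun k => (P.tauA r hs k).ht) hne
    have hk₀T : k₀ < T := mem_range.mp hk₀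
    have havg : (T : ℝ) * (P.tauA r hs k₀).ht ≤ ∑ k ∈ range T, (P.tauA r hs k).ht := by
      calc (T : ℝ) * (P.tauA r hs k₀).ht = ∑ k ∈ range T, (P.tauA r hs k₀).ht := by
            rw [sum_const, card_range, nsmul_eq_mul]
        _ ≤ ∑ k ∈ range T, (P.tauA r hs k).ht := sum_le_sum fun k hk => hmin k hk
    have hk₀ht : (P.tauA r hs k₀).ht ≤ H / (D * T) := by
      rw [le_div_iff₀ (mul_pos hDr hT)]
      nlinarith
    -- Lemma 11 from `τ^{k₀}P` to `τ^i P`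
    have htrans : (P.tauA r hs i) = (P.tauA r hs k₀).tauA r hs (i - k₀) := by
      rw [AlgPt.tauA_tauA, sub_add_cancel]
    have h11 := (P.tauA r hs k₀).ht_tauA_le r hs (i - k₀)
    rw [← htrans, P.deg_tauA r hs k₀] at h11
    -- `|i − k₀| ≤ 4T` and `T deg ≤ m ≤ D²`
    have habs_i : |((i - k₀ : ℤ) : ℝ)| ≤ 4 * T := by
      have h1 : |(i : ℝ)| < 3 * T := by exact_mod_cast hi
      have h2 : (k₀ : ℝ) < T := by exact_mod_cast hk₀T
      have h3 : (0 : ℝ) ≤ k₀ := Nat.cast_nonneg _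
      push_cast
      rw [abs_le]
      constructor <;> cases abs_lt.mp h1 <;> linarith
    have hdeg : (T : ℝ) * P.deg ≤ (D : ℝ) ^ 2 := by
      have h1 : T * P.deg ≤ D ^ 2 := hcard.trans L.hm
      exact_mod_cast h1
    have hdeg0 : (0 : ℝ) ≤ P.deg := Nat.cast_nonneg _
    calc (P.tauA r hs i).ht ≤ (P.tauA r hs k₀).ht + AlgPt.c4 r s * |((i - k₀ : ℤ) : ℝ)| * P.deg := h11
      _ ≤ H / (D * T) + AlgPt.c4 r s * (4 * T) * P.deg := by
          gcongr
      _ = H / (D * T) + 4 * AlgPt.c4 r s * (T * P.deg) := by ring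
      _ ≤ H / (D * T) + 4 * AlgPt.c4 r s * (D : ℝ) ^ 2 := by
          gcongr

end translates

end NguyenRoy

end Literature.NumberTheory.Transcendental
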